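import Summits.CriticalPhenomena.CardyFormulaZ2.Theorems.CardyIKTransportCornerLineDescentLine
import Literature.Probability.Percolation.CornerPercolation
import Literature.Probability.Percolation.BoxCrossingProofs
import Literature.Probability.RandomPlanarGeometry.PlanarDomainsTopology
import Literature.Probability.LatticeModels.IsoradialPercolationProofs

/-!
# The frozen end `p = 0` of the corner line: the continuity sub-goal for crude bond-`ℤ²` crossings and its sandwich

Support file for the registered stub `stub_FreezeHomogenisation` of the line `symmetric-seed-second-order` of the
crux `CardyIKTransport.CornerLineDescent` (stmt-CriticalPhenomena-10964), over the shared vocabulary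
`Theorems/CardyIKTransportCornerLineDescentLine.lean`.  It isolates, as ONE statement over the vocabulary, the only
percolation input of the frozen end that is not bond-`ℤ²` bookkeeping: `Freeze.CrudeCrossingContinuity R`, the
mesh-uniform insensitivity of crude bond-`ℤ²` crossing probabilities of the conformal rectangle `R` to the
discretisation of the domain within a collar of the boundary (Schramm–Smirnov 2011 Lemma 5.1/6.1 TYPE, for the crude
events `embDomainCrossing`; a SUB-GOAL OF THE LINE, not a literature statement — the tree's
`SchrammSmirnov2011_lemma_5_1/_6_1` are the `Quad` renderings and are undischarged).

* RUN EXTRACTION (`Freeze.exists_run`, graph-theoretic; `Freeze.exists_crossing_run`, geometric): a walk drawn with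
  short edges inside the ENLARGED domain `Ω ∪ collar₀ ∪ collar₂` from `collar₀ ∖ Ω` to `collar₂ ∖ Ω` contains a walk
  inside `Ω` from within one edge length of `arc 0` to within one edge length of `arc 2` (last exit from the
  `0`-side, first entry to the `2`-side; the crossing edges meet `∂Ω = ⋃ arcs` at points the collar conditions force
  onto `arc 0`, `arc 2`).  Here `collarᵢ = sideCollar R i κ` = points `κ`-close to `arc i` and `2κ`-far from the
  other three arcs.
* THE EVENTS: `upperCrossing R ρ δ` (window and targets fattened by `ρ`) and `lowerCrossing R κ ρ δ` (closed
  `ρ`-balls of the vertices inside the enlarged domain, endpoints' balls in the exterior collars), and the statement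
  `CrudeCrossingContinuity R : ∀ ε > 0, ∃ κ > 0, ∃ ρ > 0, ∀ᶠ δ → 0⁺, P(upper) ≤ P(lower) + ε`.
* THE SANDWICH for the standard lattice (anchor `crude_subset_upperCrossing`; `lowerCrossing_subset_embDomainCrossing`
  for configurations on lattice edges, an a.s. condition): `lower ⊆ crude ⊆ upper`.  The companion files couple the
  frozen gauge of `e^{iπ/4} R` at mesh `δ/2` into the same sandwich on the good-grid event.
References: Schramm–Smirnov, Ann. Probab. 39 (2011) §5–6; Bollobás–Riordan, *Percolation* (2006) Ch. 7 Lemma 14 and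
p. 195; Grimmett–Manolescu, PTRF 159 (2014) §2.2 (`embDomainCrossing`); route file `Theses/CardyIKTransport.lean`
(items 10964, 4967).
-/

noncomputable section

namespace Summit.CriticalPhenomena.CardyFormulaZ2.Theorems.CornerLineDescent.SymmetricSeed

open scoped BigOperators Topology Classical MeasureTheory ProbabilityTheory ENNReal NNReal
open Filter Set Function MeasureTheory
open Literature.Probability.Percolation (sitePercolation bondPercolation half BondConfig embDomainCrossing rectangle
  openGraph openGraph_adj openConnIn openCrossing)
open Literature.Probability.LatticeModels
open Literature.Probability.RandomPlanarGeometry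

namespace Freeze

/-! ## Run extraction: a walk from the `0`-side to the `2`-side contains a run inside, entered from the `0`-side and
left to the `2`-side -/

section RunExtraction

variable {V : Type*} {H : SimpleGraph V} (in0 in2 good : V → Prop)

/-- The combined induction behind `exists_run`: A-form (the walk starts on the `0`-side) and B-form (the walk starts
inside, at the end of a run already entered from the `0`-side). [folklore] -/
private theorem exists_run_aux (hsep : ∀ x y, in0 x → in2 y → ¬ H.Adj x y) (hdisj : ∀ x, in0 x → ¬ in2 x) :
    ∀ {x v : V} (p : H.Walk x v), in2 v → (∀ y ∈ p.support, good y) →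
      (in0 x → ∃ (a' a b b' : V) (q : H.Walk a b), in0 a' ∧ H.Adj a' a ∧ in2 b' ∧ H.Adj b b' ∧
          ∀ y ∈ q.support, good y ∧ ¬ in0 y ∧ ¬ in2 y) ∧
      ((¬ in0 x ∧ ¬ in2 x ∧ ∃ (a' a : V) (q : H.Walk a x), in0 a' ∧ H.Adj a' a ∧
          ∀ y ∈ q.support, good y ∧ ¬ in0 y ∧ ¬ in2 y) →
        ∃ (a' a b b' : V) (q : H.Walk a b), in0 a' ∧ H.Adj a' a ∧ in2 b' ∧ H.Adj b b' ∧
          ∀ y ∈ q.support, good y ∧ ¬ in0 y ∧ ¬ in2 y) := by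
  intro x v p
  induction p with
  | nil => exact fun hv _ => ⟨fun h0 => absurd hv (hdisj _ h0), fun h => absurd hv h.2.1⟩
  | cons h p ih =>
    rename_i x u₁ _
    intro hv hg
    have hg' : ∀ y ∈ p.support, good y := fun y hy => hg y (by simp [hy])
    have hgu₁ : good u₁ := hg' u₁ p.start_mem_support
    refine ⟨fun hx => ?_, fun ⟨_, _, a', a, q, ha', haa, hq⟩ => ?_⟩
    · by_cases h0 : in0 u₁
      · exact (ih hv hg').1 h0
      · by_cases h2 : in2 u₁
        · exact absurd h (hsep x u₁ hx h2)
        · exact (ih hv hg').2 ⟨h0, h2, x, u₁, SimpleGraph.Walk.nil, hx, h, fun y hy => by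
            simp only [SimpleGraph.Walk.support_nil, List.mem_singleton] at hy
            subst hy; exact ⟨hgu₁, h0, h2⟩⟩
    · by_cases h2 : in2 u₁
      · exact ⟨a', a, x, u₁, q, ha', haa, h2, h, hq⟩
      · by_cases h0 : in0 u₁
        · exact (ih hv hg').1 h0
        · refine (ih hv hg').2 ⟨h0, h2, a', a, q.concat h, ha', haa, fun y hy => ?_⟩
          rw [SimpleGraph.Walk.support_concat, List.mem_append, List.mem_singleton] at hy
          rcases hy with hy | rfl
          · exact hq y hy
          · exact ⟨hgu₁, h0, h2⟩

/-- RUN EXTRACTION.  In a walk from a `0`-side vertex to a `2`-side vertex, if no `0`-side vertex is adjacent to a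
`2`-side vertex and no vertex is on both sides, then between the LAST `0`-side vertex before the FIRST `2`-side
vertex lies a nonempty run of vertices on neither side, entered by an edge from the `0`-side and left by an edge to
the `2`-side; every property of the vertices of the walk passes to the run. [folklore] -/
theorem exists_run (hsep : ∀ x y, in0 x → in2 y → ¬ H.Adj x y) (hdisj : ∀ x, in0 x → ¬ in2 x)
    {u v : V} (p : H.Walk u v) (hu : in0 u) (hv : in2 v) (hg : ∀ y ∈ p.support, good y) :
    ∃ (a' a b b' : V) (q : H.Walk a b), in0 a' ∧ H.Adj a' a ∧ in2 b' ∧ H.Adj b b' ∧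
      ∀ y ∈ q.support, good y ∧ ¬ in0 y ∧ ¬ in2 y :=
  (exists_run_aux in0 in2 good hsep hdisj p hv hg).1 hu

end RunExtraction

/-! ## Collars of the marked arcs; the enlarged domain -/

/-- The union of the arcs other than `arc i`. [folklore] -/
def otherArcs (R : ConformalRectangle) (i : Fin 4) : Set ℂ := ⋃ (j : Fin 4) (_ : j ≠ i), R.arc j

/-- THE COLLAR OF SIDE `i` AT SCALE `κ`: points `κ`-close to `arc i` and `2κ`-far from the three other arcs (an open
set hugging the middle part of the side, on both sides of it, away from the corners). [folklore] -/
def sideCollar (R : ConformalRectangle) (i : Fin 4) (κ : ℝ) : Set ℂ :=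
  {p | Metric.infDist p (R.arc i) < κ ∧ 2 * κ < Metric.infDist p (otherArcs R i)}

/-- THE ENLARGED DOMAIN: the carrier together with the collars of the two sides `0`, `2` to be joined. [folklore] -/
def enlarge (R : ConformalRectangle) (κ : ℝ) : Set ℂ := R.carrier ∪ sideCollar R 0 κ ∪ sideCollar R 2 κ

/-- Each other arc lies in `otherArcs`. [folklore] -/
theorem arc_subset_otherArcs {R : ConformalRectangle} {i j : Fin 4} (h : j ≠ i) : R.arc j ⊆ otherArcs R i :=
  Set.subset_iUnion₂ (s := fun j (_ : j ≠ i) => R.arc j) j h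

/-- The distance to `otherArcs` is at most the distance to each other arc (arcs are nonempty). [folklore] -/
theorem infDist_otherArcs_le {R : ConformalRectangle} {i j : Fin 4} (h : j ≠ i) (p : ℂ) :
    Metric.infDist p (otherArcs R i) ≤ Metric.infDist p (R.arc j) :=
  Metric.infDist_le_infDist_of_subset (arc_subset_otherArcs h) ⟨_, R.pt_mem_arc_self j⟩

/-- No point lies in the collars of two different sides. [folklore] -/
theorem not_mem_sideCollar_of_mem {R : ConformalRectangle} {i j : Fin 4} (h : i ≠ j) {κ : ℝ} {p : ℂ}
    (hi : p ∈ sideCollar R i κ) : p ∉ sideCollar R j κ := by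
  intro hj
  have h1 := hi.1
  have h2 := hj.2
  have h3 := infDist_otherArcs_le (R := R) h p
  have h0 : 0 ≤ Metric.infDist p (R.arc i) := Metric.infDist_nonneg
  linarith

/-- Points of two different collars are more than `κ` apart. [folklore] -/
theorem lt_dist_of_mem_sideCollar {R : ConformalRectangle} {i j : Fin 4} (h : i ≠ j) {κ : ℝ} {p q : ℂ}
    (hi : p ∈ sideCollar R i κ) (hj : q ∈ sideCollar R j κ) : κ < dist p q := by
  have h1 := hi.1
  have h2 := hj.2
  have h3 := infDist_otherArcs_le (R := R) h q
  have h4 : Metric.infDist q (R.arc i) ≤ Metric.infDist p (R.arc i) + dist q p := Metric.infDist_le_infDist_add_dist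
  rw [dist_comm] at h4
  linarith

/-- A frontier point within `κ` of a collar point of side `i` lies on `arc i`. [folklore] -/
theorem mem_arc_of_mem_frontier {R : ConformalRectangle} {i : Fin 4} {κ : ℝ} {p w : ℂ} (hp : p ∈ sideCollar R i κ)
    (hw : w ∈ frontier R.carrier) (hd : dist p w ≤ κ) : w ∈ R.arc i := by
  rw [← (R.iUnion_arc_holds : ⋃ k, R.arc k = frontier R.carrier)] at hw
  obtain ⟨j, hj⟩ := Set.mem_iUnion.1 hw
  by_cases hji : j = i
  · exact hji ▸ hj
  · exfalso
    have h1 := hp.1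
    have h2 := hp.2
    have h3 := infDist_otherArcs_le (R := R) hji p
    have h4 : Metric.infDist p (R.arc j) ≤ dist p w := Metric.infDist_le_dist_of_mem hj
    have h0 : 0 ≤ Metric.infDist p (R.arc i) := Metric.infDist_nonneg
    linarith

/-! ## From a walk across the enlarged domain to a crude crossing -/

/-- GEOMETRIC RUN EXTRACTION.  Let the vertices of a graph be drawn in the plane by `P` with edges of length `≤ ℓ ≤ κ`.
A walk drawn inside the enlarged domain `Ω ∪ collar₀ ∪ collar₂`, from a vertex drawn in `collar₀ ∖ Ω` to a vertex
drawn in `collar₂ ∖ Ω`, contains a walk drawn inside `Ω` from a vertex within `ℓ` of `arc 0` to a vertex within `ℓ`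
of `arc 2` (it enters `Ω` through `arc 0` and leaves through `arc 2`: the crossing edges meet the frontier at points
which the collar conditions force onto the right arcs). [folklore] -/
theorem exists_crossing_run {V : Type*} {H : SimpleGraph V} (P : V → ℂ) {ℓ κ : ℝ} (hℓκ : ℓ ≤ κ)
    (hstep : ∀ x y, H.Adj x y → dist (P x) (P y) ≤ ℓ) (R : ConformalRectangle) {u v : V} (p : H.Walk u v)
    (hu : P u ∈ sideCollar R 0 κ \ R.carrier) (hv : P v ∈ sideCollar R 2 κ \ R.carrier)
    (hsupp : ∀ y ∈ p.support, P y ∈ enlarge R κ) :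
    ∃ (a b : V) (q : H.Walk a b), (∀ y ∈ q.support, P y ∈ R.carrier) ∧
      Metric.infDist (P a) (R.arc 0) ≤ ℓ ∧ Metric.infDist (P b) (R.arc 2) ≤ ℓ := by
  have h02 : (0 : Fin 4) ≠ 2 := by decide
  obtain ⟨a', a, b, b', q, ha', haa, hb', hbb, hq⟩ := exists_run (fun y => P y ∈ sideCollar R 0 κ \ R.carrier)
    (fun y => P y ∈ sideCollar R 2 κ \ R.carrier) (fun y => P y ∈ enlarge R κ)
    (fun x y hx hy hxy => by
      have h1 := lt_dist_of_mem_sideCollar h02 hx.1 hy.1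
      have h2 := hstep x y hxy
      linarith)
    (fun x hx hx' => not_mem_sideCollar_of_mem h02 hx.1 hx'.1) p hu hv hsupp
  have hin : ∀ y ∈ q.support, P y ∈ R.carrier := by
    intro y hy
    obtain ⟨hg, h0, h2⟩ := hq y hy
    rcases hg with (h | h) | h
    · exact h
    · by_contra hc; exact h0 ⟨h, hc⟩
    · by_contra hc; exact h2 ⟨h, hc⟩
  -- entering edge `a' — a` meets the frontier on `arc 0`, leaving edge `b — b'` on `arc 2`
  have key : ∀ {i : Fin 4} {x' x : V}, P x' ∈ sideCollar R i κ \ R.carrier → P x ∈ R.carrier → H.Adj x' x →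
      Metric.infDist (P x) (R.arc i) ≤ ℓ := by
    intro i x' x hx' hx hadj
    have hns : ¬ segment ℝ (P x) (P x') ⊆ R.carrier := fun hs => hx'.2 (hs (right_mem_segment _ _ _))
    obtain ⟨w, hw, hwf⟩ := Literature.Probability.Percolation.exists_mem_segment_frontier R.isOpen hx hns
    have hd : dist (P x') (P x) ≤ ℓ := hstep _ _ hadj
    have hw1 : dist (P x') w ≤ ℓ :=
      (Metric.mem_closedBall'.1 (segment_subset_closedBall_right (P x) (P x') hw)).trans (dist_comm (P x) (P x') ▸ hd)
    have hw2 : dist (P x) w ≤ ℓ := (Metric.mem_closedBall'.1 (segment_subset_closedBall_left (P x) (P x') hw)).trans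
      (dist_comm (P x) (P x') ▸ hd)
    have hwarc : w ∈ R.arc i := mem_arc_of_mem_frontier hx'.1 hwf (hw1.trans hℓκ)
    exact (Metric.infDist_le_dist_of_mem hwarc).trans hw2
  exact ⟨a, b, q, hin, key ha' (hin a q.start_mem_support) haa, key hb' (hin b q.end_mem_support) hbb.symm⟩

/-! ## The continuity statement for crude bond-`ℤ²` crossing probabilities -/

/-- THE UPPER (FATTENED) CRUDE CROSSING EVENT of `R` at mesh `δ` and collar width `ρ`: an open path of the standard
square lattice (`squareLatticeEmbedding.z`, mesh `δ`) all of whose vertices are within `ρ` of the carrier, from a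
vertex within `ρ` of `arc 0` to a vertex within `ρ` of `arc 2`.  For `2δ ≤ ρ` it contains the crude event
`embDomainCrossing` of the vocabulary (`embDomainCrossing_subset_upperCrossing`). [folklore] -/
def upperCrossing (R : ConformalRectangle) (ρ δ : ℝ) : Set (BondConfig (Site 2)) :=
  openCrossing {x | Metric.infDist ((δ : ℂ) * squareLatticeEmbedding.z x) R.carrier ≤ ρ}
    {x | Metric.infDist ((δ : ℂ) * squareLatticeEmbedding.z x) (R.arc 0) ≤ ρ}
    {x | Metric.infDist ((δ : ℂ) * squareLatticeEmbedding.z x) (R.arc 2) ≤ ρ}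

/-- THE LOWER (THINNED, COLLAR-TO-COLLAR) CRUDE CROSSING EVENT of `R` at mesh `δ`, collar scale `κ` and thinning
radius `ρ`: an open path of the standard square lattice whose vertices have their closed `ρ`-balls inside the
enlarged domain `Ω ∪ collar₀ ∪ collar₂`, from a vertex whose `ρ`-ball lies in `collar₀ ∖ Ω` to a vertex whose
`ρ`-ball lies in `collar₂ ∖ Ω`.  It is contained in the crude event (`lowerCrossing_subset_embDomainCrossing`, for
configurations on the lattice edges and `√2 δ ≤ κ`): such a path enters `Ω` through `arc 0` and leaves it through
`arc 2`. [folklore] -/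
def lowerCrossing (R : ConformalRectangle) (κ ρ δ : ℝ) : Set (BondConfig (Site 2)) :=
  openCrossing {x | Metric.closedBall ((δ : ℂ) * squareLatticeEmbedding.z x) ρ ⊆ enlarge R κ}
    {x | Metric.closedBall ((δ : ℂ) * squareLatticeEmbedding.z x) ρ ⊆ sideCollar R 0 κ \ R.carrier}
    {x | Metric.closedBall ((δ : ℂ) * squareLatticeEmbedding.z x) ρ ⊆ sideCollar R 2 κ \ R.carrier}

/-- `CrudeCrossingContinuity R` — MESH-UNIFORM CONTINUITY OF CRUDE BOND-`ℤ²` CROSSING PROBABILITIES IN THE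
DISCRETISATION OF THE DOMAIN (a sub-goal of the line, Schramm–Smirnov 2011 (5.1)/Lemma 6.1 TYPE but for the crude
events of a conformal rectangle; not a literature statement): for every `ε > 0` there are a collar scale `κ > 0` and a
thinning/fattening radius `ρ > 0` such that for all small meshes `δ` the fattened event exceeds the thinned
collar-to-collar event in `P_{1/2}`-probability by at most `ε`.  Both events sandwich the crude event
`embDomainCrossing` of the vocabulary, and — through the renewal-grid coupling — the frozen-gauge crude event of the
rotated rectangle `e^{iπ/4} R` at mesh `δ/2`, up to the bad-grid probability; so this is exactly what transfers
crossing limits between the two (`stub_FreezeHomogenisation_of_continuity`).  WHY TRUE: RSW in half-annuli at the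
boundary (three-arm events at scale `ρ → κ` along the sides, two-arm events at the corners at scale `κ`), as in the
printed proofs of SS11 Lemma 6.1 / Bollobás–Riordan Ch. 7 Lemma 14; the tree's `SchrammSmirnov2011_lemma_6_1` is
the `Quad`/`openEdgeUnion` rendering, undischarged. [folklore] -/
def CrudeCrossingContinuity (R : ConformalRectangle) : Prop :=
  ∀ ε : ℝ, 0 < ε → ∃ κ : ℝ, 0 < κ ∧ ∃ ρ : ℝ, 0 < ρ ∧ ∀ᶠ δ in 𝓝[>] (0:ℝ),
    (bondPercolation (zdGraph 2) half).real (upperCrossing R ρ δ) ≤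
      (bondPercolation (zdGraph 2) half).real (lowerCrossing R κ ρ δ) + ε

/-! ## The crude event is sandwiched between the lower and the upper events -/

/-- Lengths of the edges of the standard square lattice at mesh `δ`: `|δ| √2`. [folklore] -/
theorem dist_z_eq_of_adj {x y : Site 2} (h : (zdGraph 2).Adj x y) (δ : ℝ) :
    dist ((δ : ℂ) * squareLatticeEmbedding.z x) ((δ : ℂ) * squareLatticeEmbedding.z y) = |δ| * Real.sqrt 2 := by
  rw [Complex.dist_eq, ← mul_sub, norm_mul, Complex.norm_real, Real.norm_eq_abs, squareLatticeEmbedding_z,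
    squareLatticeEmbedding_z, ← mul_sub, norm_mul, Complex.norm_real, Real.norm_eq_abs,
    abs_of_nonneg (Real.sqrt_nonneg 2)]
  suffices h1 : ‖Site.toComplex x - Site.toComplex y‖ = 1 by rw [h1, mul_one]
  rcases (zdGraph_adj_iff x y).1 h with ⟨i, h | h⟩
  · rw [h, norm_sub_rev]
    fin_cases i <;> simp [Site.toComplex, Complex.norm_def, Complex.normSq_apply]
  · rw [h]
    fin_cases i <;> simp [Site.toComplex, Complex.norm_def, Complex.normSq_apply]

/-- `{x ↔ y in S}` is monotone in the window `S`. [folklore] -/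
theorem openConnIn_mono {V : Type*} {S T : Set V} (h : S ⊆ T) (x y : V) :
    (openConnIn S x y : Set (BondConfig V)) ⊆ openConnIn T x y := by
  intro ω hω
  rw [mem_openConnIn_iff_exists_openWalk] at hω ⊢
  obtain ⟨w, hw⟩ := hω
  exact ⟨w, fun v hv => h (hw v hv)⟩

/-- THE CRUDE EVENT IS BELOW THE UPPER EVENT (monotonicity in the window and the targets, `2δ ≤ ρ`). [folklore] -/
theorem embDomainCrossing_subset_upperCrossing (R : ConformalRectangle) {ρ δ : ℝ} (hδ : 0 ≤ δ) (h : 2 * δ ≤ ρ) :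
    embDomainCrossing squareLatticeEmbedding.z R.carrier δ (R.arc 0) (R.arc 2) ⊆ upperCrossing R ρ δ := by
  rintro ω ⟨x, hx, y, hy, hr⟩
  refine ⟨x, le_trans hx h, y, le_trans hy h, ?_⟩
  have hsub : {y : Site 2 | (δ : ℂ) * squareLatticeEmbedding.z y ∈ R.carrier} ⊆
      {x | Metric.infDist ((δ : ℂ) * squareLatticeEmbedding.z x) R.carrier ≤ ρ} := fun y hy => by
    simp only [Set.mem_setOf_eq] at hy ⊢
    rw [Metric.infDist_zero_of_mem hy]; linarith
  exact openConnIn_mono hsub x y hr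

/-- THE LOWER EVENT IS BELOW THE CRUDE EVENT, for configurations supported on lattice edges (an a.s. condition
under `P_{1/2}`) and meshes with `√2 δ ≤ κ`, `0 < δ`, `0 ≤ ρ`: a lattice path from `collar₀ ∖ Ω` to `collar₂ ∖ Ω`
inside the enlarged domain enters `Ω` through `arc 0` and leaves through `arc 2` (`exists_crossing_run`), and its
run inside `Ω` starts and ends within one edge length `√2 δ ≤ 2δ` of the two arcs. [folklore] -/
theorem lowerCrossing_subset_embDomainCrossing (R : ConformalRectangle) {κ ρ δ : ℝ} (hδ : 0 < δ) (hρ : 0 ≤ ρ)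
    (hκ : Real.sqrt 2 * δ ≤ κ) {ω : BondConfig (Site 2)} (hω : ω ⊆ (zdGraph 2).edgeSet)
    (h : ω ∈ lowerCrossing R κ ρ δ) :
    ω ∈ embDomainCrossing squareLatticeEmbedding.z R.carrier δ (R.arc 0) (R.arc 2) := by
  obtain ⟨u, hu, v, hv, huv⟩ := h
  rw [mem_openConnIn_iff_exists_openWalk] at huv
  obtain ⟨p, hp⟩ := huv
  set P : Site 2 → ℂ := fun x => (δ : ℂ) * squareLatticeEmbedding.z x with hP
  have hcen : ∀ x : Site 2, P x ∈ Metric.closedBall (P x) ρ := fun x => Metric.mem_closedBall_self hρ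
  have hstep : ∀ x y, (openGraph ω).Adj x y → dist (P x) (P y) ≤ Real.sqrt 2 * δ := by
    intro x y hxy
    rw [openGraph_adj] at hxy
    have hadj : (zdGraph 2).Adj x y := by
      have := hω hxy.1
      rwa [SimpleGraph.mem_edgeSet] at this
    rw [hP, dist_z_eq_of_adj hadj, abs_of_pos hδ, mul_comm]
  obtain ⟨a, b, q, hq, ha, hb⟩ := exists_crossing_run P hκ hstep R p (hu (hcen u)) (hv (hcen v))
    fun y hy => hp y hy (hcen y)
  have h2 : Real.sqrt 2 * δ ≤ 2 * δ := by
    have : Real.sqrt 2 ≤ 2 := by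
      rw [show (2:ℝ) = Real.sqrt 4 by rw [show (4:ℝ) = 2 ^ 2 by norm_num, Real.sqrt_sq zero_le_two]]
      exact Real.sqrt_le_sqrt (by norm_num)
    nlinarith
  refine ⟨a, ha.trans h2, b, hb.trans h2, ?_⟩
  rw [mem_openConnIn_iff_exists_openWalk]
  exact ⟨q, hq⟩

end Freeze

/-- ANCHOR (registered sub-goal). THE CRUDE EVENT IS BELOW THE UPPER EVENT: for `0 ≤ δ` and `2δ ≤ ρ`, the crude
crossing event of `R` at mesh `δ` on the standard square lattice is contained in the `ρ`-fattened event
`Freeze.upperCrossing R ρ δ`. [folklore] -/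
theorem crude_subset_upperCrossing : ∀ (R : ConformalRectangle) (ρ δ : ℝ), 0 ≤ δ → 2 * δ ≤ ρ → embDomainCrossing squareLatticeEmbedding.z R.carrier δ (R.arc 0) (R.arc 2) ⊆ Freeze.upperCrossing R ρ δ :=
  fun R _ _ hδ h => Freeze.embDomainCrossing_subset_upperCrossing R hδ h

end Summit.CriticalPhenomena.CardyFormulaZ2.Theorems.CornerLineDescent.SymmetricSeed
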